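import Summits.QuantumFields.YangMills.Theorems.BalabanUVNodesPortS1P0CPreckSymm
import Summits.QuantumFields.YangMills.Theorems.BalabanUVNodesPortS1SmallLetter
import Summits.QuantumFields.YangMills.Theorems.BalabanUVNodesN07AveragingLocalSmooth
import Summits.QuantumFields.YangMills.Theorems.BalabanUVNodesPortS1ClassTwins
import Literature.MathematicalPhysics.QuantumFieldTheory.Balaban1983to89.Node00.LinearisedAveragingCovariantLocal
import Literature.MathematicalPhysics.QuantumFieldTheory.Balaban1983to89.B7BlockAvgLog
import Literature.MathematicalPhysics.QuantumFieldTheory.Balaban1983to89.B11Eq177CriticalFamilyDerivative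

/-!
# NODE O port PT-A — THE CONSUMER HALF OF (M6-i): THE (2.11) FORM `recordΔk₁(V)` IS THE LAGRANGE–HESSIAN OPERATOR FORM ALONG ANY `C²` FAMILY THAT CARRIES THE VALUE
# (★★★ director-ym №667 (3) route of record, №674 GO; the supplier half — EXHIBITING the family, [15] Prop. 9 — stays with ★★ def-Y)

Cell `ym-nodeO-ideate`, porter seat `ymgap-nodeO-port-PTA-1` (payload gen 12 ∕ lineage g13); `--kind proof --supports stmt-QuantumFields-27930 --as helper`; count-neutral; theorems only.
[I] = [Balaban1987RG1]; [15] = [Balaban1985Variational]; [LF-II] = [Balaban1989LargeFieldII].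

WHY (LOCATING MEMO (M6)∕(M7) §3, ADOPTED №667; (B)-SUB-MEMO nodeO STATUS l.6506).  `ClassP2Reg` asks that the P0-ℂ carrier read at the real pair of a class point IS the real (2.11) matrix built on
`recordΔk₁ F k K εbg V hopLin = D²f(0) − 2·Df(0)∘h∘C₂ + D²G(0)`, `f := recordAUk … V = A ∘ U_k ∘ (V′ ↦ V′V)` THROUGH THE ROOTED SELECTOR (✓`…K0RecordFormatNamesFluctC` :80).  In print the
carrier is DEFINED by an explicit operator formula ([I] (1.5) p.261 «⟨H₁B, Δ₁H₁B⟩ − 2⟨H₁hC^{(2)}(B), J⟩ + G^{(2)}(B)»; p.261 L7–14 «extended, by the same formulas, to … Gᶜ-valued configurations») and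
its identification with the second jet of the value function is (2.6)–(2.8) p.266–267 ⟸ [15] (171), (174)–(177) pp.305–306 = [LF-II] (1.12) p.359: «the Hessian of `B′ ↦ A(U_k(exp(iB′)V))` at `0`
is the pull-back `H₁*Δ₁H₁`».  Lit ✓`B11Eq177CriticalFamilyDerivative` PROVES the abstract calculus (★★`hessian_value_criticalFamily`, `hasFDerivAt_value_criticalFamily`).  THIS FILE instantiates
it AT THE RECORD's NAMES, selection-free: for ANY `C²` family `x ↦ γ x` (in any real normed chart space `E`, e.g. n07-e's `expChart U₀`) that CARRIES THE VALUE (`recordAUk … V x = a (γ x)` near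
`0` — for a family of fibre-MINIMISERS this is «min = min», no orbit-uniqueness needed) over datum coordinates `Φ` with `Φ ∘ γ = id` near `0` and the Lagrange relation `Da(γ 0) = λ ∘ DΦ(γ 0)`
(tangent-criticality of the base member at a submersive chart), one has `Df(0) = λ`, `D²f(0)[u,v] = a₂(γ′u, γ′v) − λ(Φ₂(γ′u, γ′v))` (the multiplier's second-jet term VANISHES because `Φ ∘ γ = id`),
hence `recordΔk₁(V)[u,v] = a₂(γ′u,γ′v) − λ(Φ₂(γ′u,γ′v) + 2·h(C₂(u,v))) + G₂(u,v)` — an operator formula in the jets of `a`, `Φ` and the explicit `C₂`, `h`, `G₂`; with `a := A ∘ expChart U₀` the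
jet `a₂` is a trace polynomial (lit ✓`hasFDerivAt_fderiv_wilsonAction4_expChart`).  `γ′` is ANY linearised minimiser (= print's `H₁` by lit ✓`fderiv_criticalFamily_eq_linearisedMinimiser` once
`a₂ − λ∘Φ₂` is nondegenerate on `ker DΦ` — not needed here).

WHAT IS PROVED (0 `def`, 0 `sorry`, standard axioms; every non-tree ingredient — the family `γ`, the datum chart `Φ`, the value agreement, the Lagrange relation — is a HYPOTHESIS; nothing is
constructed: construction = def-Y's supplier half ([15] Prop. 9), the same existence that inhabits ✓`RegSelSmoothOnClass`).
* §1 (abstract chart `E`): `fderiv_comp_eq_id_of_eventuallyEq_id`, `fderiv_fderiv_comp_eq_zero_of_eventuallyEq_id` (jets of `Φ ∘ γ =ᶠ id`), ★★ `recordDAUk_eq_of_valueFamily` (`Df(0) = λ`),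
  ★★ `recordD2AUk_eq_of_valueFamily` (`D²f(0)[u,v] = a₂(γ′u,γ′v) − λ(Φ₂(γ′u,γ′v))`), ★★★ `recordΔk₁_eq_lagrangeForm_of_valueFamily` (the (2.11) form as the Lagrange–Hessian operator form).
* §2 (n07-e's exponential chart): ★★★ `recordΔk₁_eq_lagrangeForm_of_expChartFamily` — §1 with `a := wilsonAction4 ∘ expChart U₀`, whose `C^ω` jets are discharged by lit
  (✓`contDiff_wilsonAction4_expChart`, ✓`hasFDerivAt_fderiv_wilsonAction4_expChart`): hypotheses = a `C²` Lie-algebra family `X` with the fibre∕value∕Lagrange rows displayed.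
* §3 (the CONCRETE datum coordinates `Y ↦ su2Coord(log(Ū^k(U₀·exp Y)·Vk*))` of the `k`-fold fibre): `contDiff_su2Coord_apply`, ★ `contDiffAt_datumCoord_of_smallBelow` (C^∞ at `0` under the (0.4) guard
  `SmallBelow` at `U₀`, N07 ✓`contDiffAt_coe_avgFamily_expChart_of_smallBelow'` + `analyticAt_mlog`), ★ `datumCoord_eventuallyEq_id_of_fibre` (the FIELD-form fibre row
  `Ū^k(U₀·exp(X x)) = V′_xV^{(k)}` ⟹ the coordinate row `Φ ∘ X = id`, via ✓`coe_pert`, lit ✓`mlog_exp`, ✓`su2Coord_sum_smul_su2Gen`), ★★★ `recordΔk₁_eq_lagrangeForm_of_fibreFamily` — the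
  (2.11) form over the concrete fibre with `Φ₂ := D²Φ(0)` explicit; hypotheses: standing range, `SmallBelow` at `U₀`, `X 0 = 0`, `ContDiffAt ℝ 2 X 0`, fibre row (field form), value row,
  Lagrange row.
* §5 `recordAUk_eq_of_isBackground` («min = min»), ★★★ `recordΔk₁_eq_lagrangeForm_of_minimiserFamily` — THE SUPPLIER's INTERFACE: a `C²` Lie-algebra family `X`, `X 0 = 0`, every member a
  (0.21) MINIMISER (`IsBackground (avOfRecord) (bgReg … εbg) k (pert Vk x) (expChart U₀ (X x))`, eventually) — fibre AND value rows follow —, `SmallBelow` at `U₀`, the Lagrange row ⟹ §3's formula.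
* §4 ★ `smallBelow_gaugeAct_recordBgField_of_inRegClass` — (r2) of №674 in kernel form: at a class point the guard `SmallBelow … k` holds at EVERY gauge image of `U_{k+1}(W_B)` (the minimal orbit over
  `V^{(k)}_{ax}(W_B)`, [I] (2.2)–(2.3)), i.e. at the base member of any supplier family (✓`smallBelow_recordBgField_of_inRegClass` + lit ✓`smallBelow_gaugeAct`).

HONEST FRAMING.  Second-order calculus over the tree's own theorems; the family, the chart and the three rows are DISPLAYED hypotheses (inhabited nowhere — [15] Prop. 9 at the record is not in the
tree); nothing of Bałaban's estimates asserted, ported or discharged; `ClassP2Reg`, `RegSelSmoothOnClass`, `P0HolExtAtRecordGL` inhabited NOWHERE; ⟨27930⟩ OPEN 2∕7 · no claim; ⟨26900⟩ 0∕4;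
NODE O 0∕1; COUNT 8∕28 · K 1∕4 UNMOVED; finite `𝕋⁴_{L^K}` at fixed ε — NOT continuum ∕ OS; **the Yang–Mills mass gap (Clay) is NOT proved by any of this.**  No `sorry`, no `def`, no `instance`.
-/

noncomputable section

open scoped BigOperators Matrix.Norms.L2Operator Topology

namespace Summit.QuantumFields.YangMills.Theorems.BalabanUVNodesPortS1

open Summit.QuantumFields.YangMills.Theorems.K0RecordFormatNames
open Literature.MathematicalPhysics.QuantumFieldTheory.Balaban1983to89
open Literature.MathematicalPhysics.QuantumFieldTheory.Balaban1983to89.Node00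
open Literature.MathematicalPhysics.QuantumFieldTheory.Balaban1983to89.T4Continuum (T4Family)
open Literature.MathematicalPhysics.QuantumFieldTheory.Balaban1983to89.T4AdjointCovarianceUnitary (lieSU)
open Literature.MathematicalPhysics.QuantumFieldTheory.Balaban1983to89.B11Eq177CriticalFamilyDerivative
open _root_.Filter

variable (F : T4Family)

/-! ## §1  The value function's jets along any `C²` family that carries the value, over datum coordinates with `Φ ∘ γ = id` -/

section Abstract

variable {E : Type*} [NormedAddCommGroup E] [NormedSpace ℝ E]
variable {k K : ℕ} {εbg : ℝ} {Vk : GaugeField (F.P K) k (SU 2)}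

omit [NormedAddCommGroup E] [NormedSpace ℝ E] in
/-- If `Φ ∘ γ` agrees with the identity near `0` then its derivative at `0` is the identity. [folklore] -/
theorem fderiv_comp_eq_id_of_eventuallyEq_id {γ : (FluctIdx F k K → ℝ) → E} {Φ : E → (FluctIdx F k K → ℝ)}
    (hfib : ∀ᶠ x in 𝓝 (0 : FluctIdx F k K → ℝ), Φ (γ x) = x) :
    fderiv ℝ (fun x => Φ (γ x)) 0 = ContinuousLinearMap.id ℝ (FluctIdx F k K → ℝ) := by
  have h : (fun x => Φ (γ x)) =ᶠ[𝓝 (0 : FluctIdx F k K → ℝ)] id := hfib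
  rw [h.fderiv_eq, fderiv_id]

omit [NormedAddCommGroup E] [NormedSpace ℝ E] in
/-- If `Φ ∘ γ` agrees with the identity near `0` then its second derivative at `0` vanishes. [folklore] -/
theorem fderiv_fderiv_comp_eq_zero_of_eventuallyEq_id {γ : (FluctIdx F k K → ℝ) → E} {Φ : E → (FluctIdx F k K → ℝ)}
    (hfib : ∀ᶠ x in 𝓝 (0 : FluctIdx F k K → ℝ), Φ (γ x) = x) :
    fderiv ℝ (fun x => fderiv ℝ (fun x => Φ (γ x)) x) 0 = 0 := by
  have h : (fun x => Φ (γ x)) =ᶠ[𝓝 (0 : FluctIdx F k K → ℝ)] id := hfib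
  have h2 : (fun x => fderiv ℝ (fun x => Φ (γ x)) x) =ᶠ[𝓝 (0 : FluctIdx F k K → ℝ)] fun _ => ContinuousLinearMap.id ℝ (FluctIdx F k K → ℝ) :=
    (h.fderiv (𝕜 := ℝ)).mono fun x hx => by
      show fderiv ℝ (fun x => Φ (γ x)) x = ContinuousLinearMap.id ℝ (FluctIdx F k K → ℝ)
      rw [hx, fderiv_id]
  rw [h2.fderiv_eq, fderiv_const_apply]

/-- ★★ **THE FIRST JET OF THE VALUE FUNCTION IS THE MULTIPLIER** (envelope, first order; [LF-II] (1.12)'s `⟨δB′, H₁J⟩` term): if `recordAUk … Vk` agrees near `0` with `a ∘ γ`, `Φ ∘ γ = id` near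
`0`, and the Lagrange relation `Da(γ 0) = λ ∘ DΦ(γ 0)` holds, then `D(recordAUk … Vk)(0) = λ`. [cite: Balaban1987RG1, (2.6)–(2.7) p.266–267; Balaban1985Variational, (171) p.305; Balaban1989LargeFieldII, (1.12) p.359] -/
theorem recordDAUk_eq_of_valueFamily {a : E → ℝ} {γ : (FluctIdx F k K → ℝ) → E} {Φ : E → (FluctIdx F k K → ℝ)} {x₀ : E} (hγ₀ : γ 0 = x₀)
    {γ' : (FluctIdx F k K → ℝ) →L[ℝ] E} (hγ : HasFDerivAt γ γ' 0) (ha : DifferentiableAt ℝ a x₀) (hΦ : DifferentiableAt ℝ Φ x₀)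
    {lam : (FluctIdx F k K → ℝ) →L[ℝ] ℝ} (hlam : fderiv ℝ a x₀ = lam.comp (fderiv ℝ Φ x₀))
    (hval : ∀ᶠ x in 𝓝 (0 : FluctIdx F k K → ℝ), recordAUk F k K εbg Vk x = a (γ x))
    (hfib : ∀ᶠ x in 𝓝 (0 : FluctIdx F k K → ℝ), Φ (γ x) = x) :
    recordDAUk F k K εbg Vk = lam := by
  have hv : recordAUk F k K εbg Vk =ᶠ[𝓝 (0 : FluctIdx F k K → ℝ)] fun x => a (γ x) := hval
  rw [recordDAUk, hv.fderiv_eq, (hasFDerivAt_value_criticalFamily hγ₀ hγ ha hΦ hlam).fderiv, fderiv_comp_eq_id_of_eventuallyEq_id F hfib,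
    ContinuousLinearMap.comp_id]

/-- ★★ **THE SECOND JET OF THE VALUE FUNCTION IS THE LAGRANGE HESSIAN ON THE FAMILY's VELOCITIES** ([LF-II] (1.12)'s «H₁*Δ₁H₁» shape; [15] (174)–(177)): under the same rows with `C²` data,
`D²(recordAUk … Vk)(0)[u,v] = a₂(γ′u, γ′v) − λ(Φ₂(γ′u, γ′v))` — lit ★★`hessian_value_criticalFamily` with the multiplier's second-jet term killed by `Φ ∘ γ = id`.
[cite: Balaban1987RG1, (2.6)–(2.8) p.266–267, (1.5) p.261; Balaban1985Variational, (174)–(177) pp.305–306; Balaban1989LargeFieldII, (1.12) p.359] -/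
theorem recordD2AUk_eq_of_valueFamily {a : E → ℝ} {γ : (FluctIdx F k K → ℝ) → E} {Φ : E → (FluctIdx F k K → ℝ)} {x₀ : E} (hγ₀ : γ 0 = x₀)
    {γ' : (FluctIdx F k K → ℝ) →L[ℝ] E} (hγ : HasFDerivAt γ γ' 0) {γ₂ : (FluctIdx F k K → ℝ) →L[ℝ] (FluctIdx F k K → ℝ) →L[ℝ] E}
    (hγ₂ : HasFDerivAt (fun x => fderiv ℝ γ x) γ₂ 0) (hγd : ∀ᶠ x in 𝓝 (0 : FluctIdx F k K → ℝ), DifferentiableAt ℝ γ x)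
    {a₂ : E →L[ℝ] E →L[ℝ] ℝ} (ha₂ : HasFDerivAt (fun y => fderiv ℝ a y) a₂ x₀) (had : ∀ᶠ y in 𝓝 x₀, DifferentiableAt ℝ a y)
    {Φ₂ : E →L[ℝ] E →L[ℝ] (FluctIdx F k K → ℝ)} (hΦ₂ : HasFDerivAt (fun y => fderiv ℝ Φ y) Φ₂ x₀) (hΦd : ∀ᶠ y in 𝓝 x₀, DifferentiableAt ℝ Φ y)
    {lam : (FluctIdx F k K → ℝ) →L[ℝ] ℝ} (hlam : fderiv ℝ a x₀ = lam.comp (fderiv ℝ Φ x₀))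
    (hval : ∀ᶠ x in 𝓝 (0 : FluctIdx F k K → ℝ), recordAUk F k K εbg Vk x = a (γ x))
    (hfib : ∀ᶠ x in 𝓝 (0 : FluctIdx F k K → ℝ), Φ (γ x) = x) (u v : FluctIdx F k K → ℝ) :
    recordD2AUk F k K εbg Vk u v = a₂ (γ' u) (γ' v) - lam (Φ₂ (γ' u) (γ' v)) := by
  have hv : recordAUk F k K εbg Vk =ᶠ[𝓝 (0 : FluctIdx F k K → ℝ)] fun x => a (γ x) := hval
  have h1 : fderiv ℝ (fun x => fderiv ℝ (recordAUk F k K εbg Vk) x) 0 = fderiv ℝ (fun x => fderiv ℝ (fun x => a (γ x)) x) 0 := hv.fderiv.fderiv_eq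
  rw [recordD2AUk, h1, hessian_value_criticalFamily hγ₀ hγ hγ₂ hγd ha₂ had hΦ₂ hΦd hlam u v, fderiv_fderiv_comp_eq_zero_of_eventuallyEq_id F hfib]
  simp

/-- ★★★ **THE (2.11) FORM IS THE LAGRANGE–HESSIAN OPERATOR FORM ALONG ANY `C²` FAMILY THAT CARRIES THE VALUE**: under §1's rows,
`recordΔk₁ F k K εbg Vk hopLin u v = a₂(γ′u, γ′v) − λ(Φ₂(γ′u, γ′v) + 2·hopLin(C₂(u,v))) + G₂(u,v)` — [I]'s identification (2.6)–(2.8)∕(2.10)–(2.11) of the order-`g_k⁰` quadratic form with the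
operator formula (1.5) (`a₂ ↔ Δ₁` pulled back by `γ′ ↔ H₁`, `λ ↔ ⟨·, J⟩ ∘ H₁`, `C₂`, `h`, `G₂` explicit), selection-free and WITHOUT orbit-uniqueness (the value row is «min = min»).  The P0-ℂ
supplier who defines `TC` by the holomorphic extension of the right-hand side gets (P2) at every class point from this identity + his family.
[cite: Balaban1987RG1, (1.5) p.261, p.261 L7–14, (2.6)–(2.8) p.266–267, (2.10)–(2.11) p.267; Balaban1985Variational, (171) p.305, (174)–(177) pp.305–306, Prop. 9 p.309; Balaban1989LargeFieldII, (1.12) p.359] -/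
theorem recordΔk₁_eq_lagrangeForm_of_valueFamily (hopLin : (PBond (F.P K) (k + 1) → MatA 2) →ₗ[ℝ] (FluctIdx F k K → ℝ))
    {a : E → ℝ} {γ : (FluctIdx F k K → ℝ) → E} {Φ : E → (FluctIdx F k K → ℝ)} {x₀ : E} (hγ₀ : γ 0 = x₀)
    {γ' : (FluctIdx F k K → ℝ) →L[ℝ] E} (hγ : HasFDerivAt γ γ' 0) {γ₂ : (FluctIdx F k K → ℝ) →L[ℝ] (FluctIdx F k K → ℝ) →L[ℝ] E}
    (hγ₂ : HasFDerivAt (fun x => fderiv ℝ γ x) γ₂ 0) (hγd : ∀ᶠ x in 𝓝 (0 : FluctIdx F k K → ℝ), DifferentiableAt ℝ γ x)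
    {a₂ : E →L[ℝ] E →L[ℝ] ℝ} (ha₂ : HasFDerivAt (fun y => fderiv ℝ a y) a₂ x₀) (had : ∀ᶠ y in 𝓝 x₀, DifferentiableAt ℝ a y)
    {Φ₂ : E →L[ℝ] E →L[ℝ] (FluctIdx F k K → ℝ)} (hΦ₂ : HasFDerivAt (fun y => fderiv ℝ Φ y) Φ₂ x₀) (hΦd : ∀ᶠ y in 𝓝 x₀, DifferentiableAt ℝ Φ y)
    {lam : (FluctIdx F k K → ℝ) →L[ℝ] ℝ} (hlam : fderiv ℝ a x₀ = lam.comp (fderiv ℝ Φ x₀))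
    (hval : ∀ᶠ x in 𝓝 (0 : FluctIdx F k K → ℝ), recordAUk F k K εbg Vk x = a (γ x))
    (hfib : ∀ᶠ x in 𝓝 (0 : FluctIdx F k K → ℝ), Φ (γ x) = x) (u v : FluctIdx F k K → ℝ) :
    recordΔk₁ F k K εbg Vk hopLin u v =
      a₂ (γ' u) (γ' v) - lam (Φ₂ (γ' u) (γ' v) + (2 : ℝ) • hopLin (recordC2 F k K Vk u v)) + recordG₂ F k K Vk u v := by
  rw [recordΔk₁_apply, recordD2AUk_eq_of_valueFamily F hγ₀ hγ hγ₂ hγd ha₂ had hΦ₂ hΦd hlam hval hfib u v,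
    recordDAUk_eq_of_valueFamily F hγ₀ hγ had.self_of_nhds hΦd.self_of_nhds hlam hval hfib, map_add, map_smul, smul_eq_mul]
  ring

end Abstract

/-! ## §2  Along n07-e's exponential chart: the Wilson action's jets discharged by lit -/

section ExpChart

variable {k K : ℕ} {εbg : ℝ} {Vk : GaugeField (F.P K) k (SU 2)}

/-- ★★★ **THE (2.11) FORM ALONG A `C²` LIE-ALGEBRA FAMILY IN THE EXPONENTIAL CHART**: for a fine background `U₀`, a `C²` family `x ↦ X x` of Lie-algebra fields with `X 0 = X₀`, datum coordinates
`Φ` (`C²` at `X₀`) with `Φ (X x) = x` near `0`, the VALUE row `recordAUk … Vk x = A(expChart U₀ (X x))` near `0` and the Lagrange row `D(A ∘ expChart U₀)(X₀) = λ ∘ DΦ(X₀)`: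
`recordΔk₁ F k K εbg Vk hopLin u v = D²(A ∘ expChart U₀)(X₀)(X′u, X′v) − λ(D²Φ(X₀)(X′u, X′v) + 2·hopLin(C₂(u,v))) + G₂(u,v)`, the action's `C^ω` jets by lit ✓`contDiff_wilsonAction4_expChart` ∕
✓`hasFDerivAt_fderiv_wilsonAction4_expChart`.  The supplier's half is to EXHIBIT such an `X` (a family of fibre-minimisers over `V′ ↦ V′Vk` through `U₀`: [15] Prop. 9), whose `X′` is his `H₁`.
[cite: Balaban1987RG1, (1.5) p.261, (2.6)–(2.8) p.266–267, (2.10)–(2.11) p.267; Balaban1985Variational, (174)–(177) pp.305–306, Prop. 9 p.309; Balaban1989LargeFieldII, (1.12) p.359] -/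
theorem recordΔk₁_eq_lagrangeForm_of_expChartFamily (hopLin : (PBond (F.P K) (k + 1) → MatA 2) →ₗ[ℝ] (FluctIdx F k K → ℝ)) (U₀ : GaugeField (F.P K) 0 (SU 2))
    {X : (FluctIdx F k K → ℝ) → (PBond (F.P K) 0 → lieSU (Fin 2))} {X₀ : PBond (F.P K) 0 → lieSU (Fin 2)} (hX₀ : X 0 = X₀)
    {X' : (FluctIdx F k K → ℝ) →L[ℝ] (PBond (F.P K) 0 → lieSU (Fin 2))} (hX : HasFDerivAt X X' 0)
    {X₂ : (FluctIdx F k K → ℝ) →L[ℝ] (FluctIdx F k K → ℝ) →L[ℝ] (PBond (F.P K) 0 → lieSU (Fin 2))}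
    (hX₂ : HasFDerivAt (fun x => fderiv ℝ X x) X₂ 0) (hXd : ∀ᶠ x in 𝓝 (0 : FluctIdx F k K → ℝ), DifferentiableAt ℝ X x)
    {Φ : (PBond (F.P K) 0 → lieSU (Fin 2)) → (FluctIdx F k K → ℝ)} {Φ₂ : (PBond (F.P K) 0 → lieSU (Fin 2)) →L[ℝ] (PBond (F.P K) 0 → lieSU (Fin 2)) →L[ℝ] (FluctIdx F k K → ℝ)}
    (hΦ₂ : HasFDerivAt (fun Y => fderiv ℝ Φ Y) Φ₂ X₀) (hΦd : ∀ᶠ Y in 𝓝 X₀, DifferentiableAt ℝ Φ Y)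
    {lam : (FluctIdx F k K → ℝ) →L[ℝ] ℝ} (hlam : fderiv ℝ (fun Y => wilsonAction4 (expChart U₀ Y)) X₀ = lam.comp (fderiv ℝ Φ X₀))
    (hval : ∀ᶠ x in 𝓝 (0 : FluctIdx F k K → ℝ), recordAUk F k K εbg Vk x = wilsonAction4 (expChart U₀ (X x)))
    (hfib : ∀ᶠ x in 𝓝 (0 : FluctIdx F k K → ℝ), Φ (X x) = x) (u v : FluctIdx F k K → ℝ) :
    recordΔk₁ F k K εbg Vk hopLin u v =
      fderiv ℝ (fun Y => fderiv ℝ (fun Y : PBond (F.P K) 0 → lieSU (Fin 2) => wilsonAction4 (expChart U₀ Y)) Y) X₀ (X' u) (X' v)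
        - lam (Φ₂ (X' u) (X' v) + (2 : ℝ) • hopLin (recordC2 F k K Vk u v)) + recordG₂ F k K Vk u v :=
  recordΔk₁_eq_lagrangeForm_of_valueFamily F hopLin hX₀ hX hX₂ hXd (hasFDerivAt_fderiv_wilsonAction4_expChart U₀ X₀)
    (Filter.Eventually.of_forall fun Y => ((contDiff_wilsonAction4_expChart U₀).differentiable (by simp)).differentiableAt) hΦ₂ hΦd hlam hval hfib u v

end ExpChart

/-! ## §3  The CONCRETE datum coordinates of the `k`-fold averaging fibre over `V′ ↦ V′V^{(k)}`: smoothness under the (0.4) guard, and the fibre row in field form -/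

section Datum

open Literature.MathematicalPhysics.QuantumFieldTheory.Balaban1983to89.BlockAveraging (Small)
open Literature.MathematicalPhysics.QuantumFieldTheory.Balaban1983to89.ExpMeanLog (expMeanLogSU)
open Summit.QuantumFields.YangMills.BalabanUVNodes
open NormedSpace (exp)
open _root_.Matrix

variable {k K : ℕ} {εbg : ℝ}

/-- Each Pauli coordinate `M ↦ su2Coord M a` is `C^∞` (a real-linear functional of the matrix). [cite: Balaban1987RG1, (2.4) p.266 (bookkeeping)] -/
theorem contDiff_su2Coord_apply (a : Fin 3) : ContDiff ℝ ⊤ (fun M : MatA 2 => su2Coord M a) := by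
  have hent : ∀ i j : Fin 2, ContDiff ℝ ⊤ (fun M : MatA 2 => M i j) := fun i j =>
    (LinearMap.toContinuousLinearMap (⟨⟨fun M : MatA 2 => M i j, fun _ _ => rfl⟩, fun _ _ => rfl⟩ : MatA 2 →ₗ[ℝ] ℂ)).contDiff
  have him : ∀ i j : Fin 2, ContDiff ℝ ⊤ (fun M : MatA 2 => (M i j).im) := fun i j => Complex.imCLM.contDiff.comp (hent i j)
  have hre : ∀ i j : Fin 2, ContDiff ℝ ⊤ (fun M : MatA 2 => (M i j).re) := fun i j => Complex.reCLM.contDiff.comp (hent i j)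
  fin_cases a
  · simpa [su2Coord] using him 0 1
  · simpa [su2Coord] using hre 0 1
  · simpa [su2Coord] using him 0 0

/-- ★ **THE DATUM COORDINATES ARE `C^∞` AT THE BASE UNDER THE (0.4) GUARD**: if `U₀` is guarded below level `k` (`SmallBelow`) and lies on the fibre of `Vk` (`Ū^k(U₀) = Vk`), then
`Y ↦ (p ↦ su2Coord(log(Ū^k(U₀·exp Y)(p₁)·Vk(p₁)*))(p₂))` is `C^∞` at `Y = 0` — the `k`-fold average along the exponential chart is `C^∞` (N07 ✓`contDiffAt_coe_avgFamily_expChart_of_smallBelow'`), its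
value at `0` times `Vk*` is `1`, and the series logarithm is analytic at `1`. [cite: Balaban1987RG1, (0.4) p.253, (0.21) p.256, (2.4) p.266; Balaban1985Variational, Prop. 9 p.309] -/
theorem contDiffAt_datumCoord_of_smallBelow (hk : k ≤ (F.P K).m + (F.P K).K) (U₀ : GaugeField (F.P K) 0 (SU 2)) (Vk : GaugeField (F.P K) k (SU 2))
    (hsb : SmallBelow (avOfRecord F 2 K) k U₀) (hU₀V : Averaging.iter (avOfRecord F 2 K) k U₀ = Vk) :
    ContDiffAt ℝ ⊤ (fun Y : PBond (F.P K) 0 → lieSU (Fin 2) => fun p : FluctIdx F k K =>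
      su2Coord (MatrixLog.mlog ((((Averaging.iter (avOfRecord F 2 K) k (expChart U₀ Y)) p.1 : SU 2) : MatA 2) * star (((Vk p.1 : SU 2)) : MatA 2))) p.2) 0 := by
  refine contDiffAt_pi.2 fun p => ?_
  have havg : ContDiffAt ℝ ⊤ (fun Y : PBond (F.P K) 0 → lieSU (Fin 2) =>
      ((Averaging.iter (avOfRecord F 2 K) k (expChart U₀ Y) p.1 : SU 2) : MatA 2)) 0 :=
    N07AveragingLocalSmooth.contDiffAt_coe_avgFamily_expChart_of_smallBelow' (N := 2) hk hsb le_rfl p.1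
  have hprod : ContDiffAt ℝ ⊤ (fun Y : PBond (F.P K) 0 → lieSU (Fin 2) =>
      ((Averaging.iter (avOfRecord F 2 K) k (expChart U₀ Y) p.1 : SU 2) : MatA 2) * star (((Vk p.1 : SU 2)) : MatA 2)) 0 := havg.mul contDiffAt_const
  have h0 : ((Averaging.iter (avOfRecord F 2 K) k (expChart U₀ 0) p.1 : SU 2) : MatA 2) * star (((Vk p.1 : SU 2)) : MatA 2) = 1 := by
    rw [expChart_zero, hU₀V]
    exact (Matrix.mem_unitaryGroup_iff).mp (Matrix.mem_specialUnitaryGroup_iff.mp (Vk p.1).2).1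
  have hmlog : ContDiffAt ℝ ⊤ (MatrixLog.mlog : MatA 2 → MatA 2)
      ((fun Y : PBond (F.P K) 0 → lieSU (Fin 2) => ((Averaging.iter (avOfRecord F 2 K) k (expChart U₀ Y) p.1 : SU 2) : MatA 2) * star (((Vk p.1 : SU 2)) : MatA 2)) 0) := by
    have e : (fun Y : PBond (F.P K) 0 → lieSU (Fin 2) => ((Averaging.iter (avOfRecord F 2 K) k (expChart U₀ Y) p.1 : SU 2) : MatA 2) * star (((Vk p.1 : SU 2)) : MatA 2)) 0 = 1 := h0
    rw [e]
    exact ((MatrixLog.analyticAt_mlog (𝔄 := MatA 2) (X := 1) (by simp)).contDiffAt).restrict_scalars ℝ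
  have hcomp := hmlog.comp 0 hprod
  have hfin := (contDiff_su2Coord_apply p.2).contDiffAt.comp 0 hcomp
  exact hfin

/-- ★ **THE FIBRE ROW IN FIELD FORM GIVES THE COORDINATE ROW**: if the family's `k`-fold average IS the perturbed coarse field, `Ū^k(U₀·exp(X x)) = V′_x·V^{(k)}` near `x = 0`, then the datum
coordinates of `X x` ARE `x` near `0` (`↑(V′_xVk)(b)·↑Vk(b)* = exp(B′(b))`, `log exp = id` on `‖B′(b)‖ < log 2`, Pauli coordinates of `B′(b)` = `x(b, ·)`).
[cite: Balaban1987RG1, (2.4) p.266, (0.21) p.256 (bookkeeping)] -/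
theorem datumCoord_eventuallyEq_id_of_fibre (U₀ : GaugeField (F.P K) 0 (SU 2)) (Vk : GaugeField (F.P K) k (SU 2))
    {X : (FluctIdx F k K → ℝ) → (PBond (F.P K) 0 → lieSU (Fin 2))}
    (hfibre : ∀ᶠ x in 𝓝 (0 : FluctIdx F k K → ℝ), Averaging.iter (avOfRecord F 2 K) k (expChart U₀ (X x)) = pert F k K Vk x) :
    ∀ᶠ x in 𝓝 (0 : FluctIdx F k K → ℝ),
      (fun p : FluctIdx F k K => su2Coord (MatrixLog.mlog ((((Averaging.iter (avOfRecord F 2 K) k (expChart U₀ (X x))) p.1 : SU 2) : MatA 2) *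
        star (((Vk p.1 : SU 2)) : MatA 2))) p.2) = x := by
  -- near `0` every `B′(b)` has norm `< log 2`
  have hsmall : ∀ᶠ x in 𝓝 (0 : FluctIdx F k K → ℝ), ∀ b : PBond (F.P K) k, ‖fluctMat F k K x b‖ < Real.log 2 := by
    have hlog2 : (0 : ℝ) < Real.log 2 := Real.log_pos (by norm_num)
    have hb : ∀ b : PBond (F.P K) k, ∀ᶠ x in 𝓝 (0 : FluctIdx F k K → ℝ), ‖fluctMat F k K x b‖ < Real.log 2 := by
      intro b
      have hc : Continuous fun x : FluctIdx F k K → ℝ => fluctMat F k K x b := (contDiff_fluctMat F k K b).continuous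
      have h0 : ‖fluctMat F k K (0 : FluctIdx F k K → ℝ) b‖ < Real.log 2 := by
        simp [fluctMat, hlog2]
      exact (hc.norm.tendsto 0).eventually (gt_mem_nhds h0)
    exact Filter.eventually_all.2 hb
  filter_upwards [hfibre, hsmall] with x hx hs
  funext p
  rw [hx, coe_pert, mul_assoc, (Matrix.mem_unitaryGroup_iff).mp (Matrix.mem_specialUnitaryGroup_iff.mp (Vk p.1).2).1, mul_one,
    B7BlockAvgLog.mlog_exp (hs p.1)]
  show su2Coord (∑ a, ((x (p.1, a) : ℝ) : ℂ) • su2Gen a) p.2 = x p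
  rw [su2Coord_sum_smul_su2Gen]

/-- ★★★ **THE (2.11) FORM OVER THE CONCRETE `k`-FOLD FIBRE**: for a fine background `U₀` guarded below `k` (standing range) and a `C²` Lie-algebra family `X` with `X 0 = 0` whose members'
`k`-fold averages ARE the perturbed coarse fields (`Ū^k(U₀·exp(X x)) = V′_xV^{(k)}` near `0` — in particular `Ū^k(U₀) = V^{(k)}`), which CARRIES THE VALUE (`recordAUk … x = A(U₀·exp(X x))` near
`0`: «min = min» for fibre-minimisers) and satisfies the Lagrange row at the base w.r.t. the datum coordinates `Φ`, the (2.11) form is the Lagrange–Hessian operator form of §2 with `Φ₂ := D²Φ(0)`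
EXPLICIT (the second jet of the `k`-fold average along the chart).  Every row displayed; the family is a binder.
[cite: Balaban1987RG1, (1.5) p.261, (2.6)–(2.8) p.266–267, (2.10)–(2.11) p.267, (0.21) p.256; Balaban1985Variational, (171) p.305, (174)–(177) pp.305–306, Prop. 9 p.309; Balaban1989LargeFieldII, (1.12) p.359] -/
theorem recordΔk₁_eq_lagrangeForm_of_fibreFamily (hk : k ≤ (F.P K).m + (F.P K).K) (Vk : GaugeField (F.P K) k (SU 2))
    (hopLin : (PBond (F.P K) (k + 1) → MatA 2) →ₗ[ℝ] (FluctIdx F k K → ℝ)) (U₀ : GaugeField (F.P K) 0 (SU 2)) (hsb : SmallBelow (avOfRecord F 2 K) k U₀)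
    {X : (FluctIdx F k K → ℝ) → (PBond (F.P K) 0 → lieSU (Fin 2))} (hX0 : X 0 = 0) (hXc : ContDiffAt ℝ 2 X 0)
    (hfibre : ∀ᶠ x in 𝓝 (0 : FluctIdx F k K → ℝ), Averaging.iter (avOfRecord F 2 K) k (expChart U₀ (X x)) = pert F k K Vk x)
    (hval : ∀ᶠ x in 𝓝 (0 : FluctIdx F k K → ℝ), recordAUk F k K εbg Vk x = wilsonAction4 (expChart U₀ (X x)))
    {lam : (FluctIdx F k K → ℝ) →L[ℝ] ℝ}
    (hlam : fderiv ℝ (fun Y => wilsonAction4 (expChart U₀ Y)) 0 = lam.comp (fderiv ℝ (fun Y : PBond (F.P K) 0 → lieSU (Fin 2) => fun p : FluctIdx F k K =>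
      su2Coord (MatrixLog.mlog ((((Averaging.iter (avOfRecord F 2 K) k (expChart U₀ Y)) p.1 : SU 2) : MatA 2) * star (((Vk p.1 : SU 2)) : MatA 2))) p.2) 0))
    (u v : FluctIdx F k K → ℝ) :
    recordΔk₁ F k K εbg Vk hopLin u v =
      fderiv ℝ (fun Y => fderiv ℝ (fun Y : PBond (F.P K) 0 → lieSU (Fin 2) => wilsonAction4 (expChart U₀ Y)) Y) 0 (fderiv ℝ X 0 u) (fderiv ℝ X 0 v)
        - lam (fderiv ℝ (fun Y => fderiv ℝ (fun Y : PBond (F.P K) 0 → lieSU (Fin 2) => fun p : FluctIdx F k K =>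
            su2Coord (MatrixLog.mlog ((((Averaging.iter (avOfRecord F 2 K) k (expChart U₀ Y)) p.1 : SU 2) : MatA 2) * star (((Vk p.1 : SU 2)) : MatA 2))) p.2) Y) 0
              (fderiv ℝ X 0 u) (fderiv ℝ X 0 v) + (2 : ℝ) • hopLin (recordC2 F k K Vk u v)) + recordG₂ F k K Vk u v := by
  -- the base member lies on the fibre of `Vk`
  have hU₀V : Averaging.iter (avOfRecord F 2 K) k U₀ = Vk := by
    have h := hfibre.self_of_nhds
    rwa [hX0, expChart_zero, pert_zero] at h
  -- jets of `X` from `C²`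
  have hX : HasFDerivAt X (fderiv ℝ X 0) 0 := (hXc.differentiableAt (by norm_num)).hasFDerivAt
  have hX₂ : HasFDerivAt (fun x => fderiv ℝ X x) (fderiv ℝ (fun x => fderiv ℝ X x) 0) 0 :=
    ((hXc.fderiv_right (m := 1) le_rfl).differentiableAt one_ne_zero).hasFDerivAt
  have hXd : ∀ᶠ x in 𝓝 (0 : FluctIdx F k K → ℝ), DifferentiableAt ℝ X x :=
    (hXc.eventually (by simp)).mono fun x hx => hx.differentiableAt (by norm_num)
  -- jets of the datum coordinates from `C^∞` at `0 = X 0`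
  have hΦc := contDiffAt_datumCoord_of_smallBelow F hk U₀ Vk hsb hU₀V
  have hΦc2 : ContDiffAt ℝ 2 (fun Y : PBond (F.P K) 0 → lieSU (Fin 2) => fun p : FluctIdx F k K =>
      su2Coord (MatrixLog.mlog ((((Averaging.iter (avOfRecord F 2 K) k (expChart U₀ Y)) p.1 : SU 2) : MatA 2) * star (((Vk p.1 : SU 2)) : MatA 2))) p.2) (X 0) := by
    rw [hX0]; exact hΦc.of_le le_top
  have hΦ₂ : HasFDerivAt (fun Y => fderiv ℝ (fun Y : PBond (F.P K) 0 → lieSU (Fin 2) => fun p : FluctIdx F k K =>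
      su2Coord (MatrixLog.mlog ((((Averaging.iter (avOfRecord F 2 K) k (expChart U₀ Y)) p.1 : SU 2) : MatA 2) * star (((Vk p.1 : SU 2)) : MatA 2))) p.2) Y)
      (fderiv ℝ (fun Y => fderiv ℝ (fun Y : PBond (F.P K) 0 → lieSU (Fin 2) => fun p : FluctIdx F k K =>
        su2Coord (MatrixLog.mlog ((((Averaging.iter (avOfRecord F 2 K) k (expChart U₀ Y)) p.1 : SU 2) : MatA 2) * star (((Vk p.1 : SU 2)) : MatA 2))) p.2) Y) (X 0)) (X 0) :=
    ((hΦc2.fderiv_right (m := 1) le_rfl).differentiableAt one_ne_zero).hasFDerivAt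
  have hΦd := (hΦc2.eventually (by simp)).mono fun Y hY => hY.differentiableAt (by norm_num)
  have hlam' : fderiv ℝ (fun Y => wilsonAction4 (expChart U₀ Y)) (X 0) = lam.comp (fderiv ℝ (fun Y : PBond (F.P K) 0 → lieSU (Fin 2) => fun p : FluctIdx F k K =>
      su2Coord (MatrixLog.mlog ((((Averaging.iter (avOfRecord F 2 K) k (expChart U₀ Y)) p.1 : SU 2) : MatA 2) * star (((Vk p.1 : SU 2)) : MatA 2))) p.2) (X 0)) := by
    rw [hX0]; exact hlam
  have h := recordΔk₁_eq_lagrangeForm_of_expChartFamily F hopLin U₀ rfl hX hX₂ hXd hΦ₂ hΦd hlam' hval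
    (datumCoord_eventuallyEq_id_of_fibre F U₀ Vk hfibre) u v
  rw [h, hX0]

end Datum

/-! ## §5  The supplier's interface in print's words: a `C²` family of (0.21) MINIMISERS through a guarded base member (fibre row and value row both follow) -/

section Minimiser

variable {k K : ℕ} {εbg : ℝ}

/-- **THE VALUE ROW IS «min = min»**: if `U` is a (0.21) minimiser over `V′_xV^{(k)}` in the regularity class of radius `εbg` then `recordAUk … Vk x = A(U)` — the rooted selector's value is a
minimiser over the same fibre (✓`wilsonAction4_UkSel`, ✓`wilsonAction4_eq_of_isBackground`); no orbit-uniqueness needed. [cite: Balaban1987RG1, (0.21) p.256, (1.1) p.260, (2.6) p.266] -/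
theorem recordAUk_eq_of_isBackground (hk : k ≤ (F.P K).m + (F.P K).K) (Vk : GaugeField (F.P K) k (SU 2)) {x : FluctIdx F k K → ℝ} {U : GaugeField (F.P K) 0 (SU 2)}
    (h : IsBackground (avOfRecord F 2 K) (bgReg F 2 K k εbg) k (pert F k K Vk x) U) : recordAUk F k K εbg Vk x = wilsonAction4 U := by
  show wilsonAction4 (UkSel F 2 K k εbg (pert F k K Vk x)) = wilsonAction4 U
  rw [wilsonAction4_UkSel hk, ← wilsonAction4_eq_of_isBackground h]

/-- ★★★ **THE (2.11) FORM ALONG A `C²` FAMILY OF (0.21) MINIMISERS** — the brick in the supplier's currency: for a fine background `U₀` guarded below `k` and a `C²` Lie-algebra family `X`, `X 0 = 0`,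
such that EVERY member `U₀·exp(X x)` (for `x` near `0`) IS A (0.21) MINIMISER over the perturbed coarse field `V′_xV^{(k)}` in the class of radius `εbg` (`IsBackground` — fibre row AND value row
follow: `recordAUk_eq_of_isBackground`), plus the Lagrange row at the base w.r.t. the datum coordinates, `recordΔk₁(V^{(k)})` is the Lagrange–Hessian operator form of §3.  This is [15] Prop. 9's
family read at the record: the supplier (★★ def-Y) EXHIBITS `X` (analytic in print) and its multiplier; `fderiv X 0` is his `H₁`.
[cite: Balaban1987RG1, (0.21) p.256, (1.1) p.260, (1.5) p.261, (2.6)–(2.8) p.266–267, (2.10)–(2.11) p.267; Balaban1985Variational, Thm 1 p.279, (171) p.305, (174)–(177) pp.305–306, Prop. 9 p.309;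
Balaban1989LargeFieldII, (1.12) p.359] -/
theorem recordΔk₁_eq_lagrangeForm_of_minimiserFamily (hk : k ≤ (F.P K).m + (F.P K).K) (Vk : GaugeField (F.P K) k (SU 2))
    (hopLin : (PBond (F.P K) (k + 1) → MatA 2) →ₗ[ℝ] (FluctIdx F k K → ℝ)) (U₀ : GaugeField (F.P K) 0 (SU 2)) (hsb : SmallBelow (avOfRecord F 2 K) k U₀)
    {X : (FluctIdx F k K → ℝ) → (PBond (F.P K) 0 → lieSU (Fin 2))} (hX0 : X 0 = 0) (hXc : ContDiffAt ℝ 2 X 0)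
    (hmin : ∀ᶠ x in 𝓝 (0 : FluctIdx F k K → ℝ), IsBackground (avOfRecord F 2 K) (bgReg F 2 K k εbg) k (pert F k K Vk x) (expChart U₀ (X x)))
    {lam : (FluctIdx F k K → ℝ) →L[ℝ] ℝ}
    (hlam : fderiv ℝ (fun Y => wilsonAction4 (expChart U₀ Y)) 0 = lam.comp (fderiv ℝ (fun Y : PBond (F.P K) 0 → lieSU (Fin 2) => fun p : FluctIdx F k K =>
      su2Coord (MatrixLog.mlog ((((Averaging.iter (avOfRecord F 2 K) k (expChart U₀ Y)) p.1 : SU 2) : MatA 2) * star (((Vk p.1 : SU 2)) : MatA 2))) p.2) 0))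
    (u v : FluctIdx F k K → ℝ) :
    recordΔk₁ F k K εbg Vk hopLin u v =
      fderiv ℝ (fun Y => fderiv ℝ (fun Y : PBond (F.P K) 0 → lieSU (Fin 2) => wilsonAction4 (expChart U₀ Y)) Y) 0 (fderiv ℝ X 0 u) (fderiv ℝ X 0 v)
        - lam (fderiv ℝ (fun Y => fderiv ℝ (fun Y : PBond (F.P K) 0 → lieSU (Fin 2) => fun p : FluctIdx F k K =>
            su2Coord (MatrixLog.mlog ((((Averaging.iter (avOfRecord F 2 K) k (expChart U₀ Y)) p.1 : SU 2) : MatA 2) * star (((Vk p.1 : SU 2)) : MatA 2))) p.2) Y) 0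
              (fderiv ℝ X 0 u) (fderiv ℝ X 0 v) + (2 : ℝ) • hopLin (recordC2 F k K Vk u v)) + recordG₂ F k K Vk u v :=
  recordΔk₁_eq_lagrangeForm_of_fibreFamily F hk Vk hopLin U₀ hsb hX0 hXc (hmin.mono fun _ hx => hx.1)
    (hmin.mono fun _ hx => recordAUk_eq_of_isBackground F hk Vk hx) hlam u v

end Minimiser

/-! ## §4  (r2) of ★★★ №674 in kernel form: the (0.4) guard at the base member of any family through `U_k(V^{(k)}_{ax}(W_B))` -/

section ClassGuard

variable (a₀ ε₂₉ : ℝ) (Mc k n : ℕ) {ε₀ : ℝ}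

/-- ★ **AT A CLASS POINT EVERY RESIDUAL-GAUGE IMAGE OF THE ROOTED BACKGROUND IS GUARDED BELOW `k`**: for `0 < ε₀ ≤ 1∕(53581824·L⁶)` and `InRegClass … ε₀ … B`, `SmallBelow (avOfRecord …) k (U_{k+1}(W_B)^u)`
for EVERY fine gauge transformation `u` (✓`smallBelow_recordBgField_of_inRegClass` + lit ✓`smallBelow_gaugeAct`) — so the `hsb` row of ✓`recordΔk₁_eq_lagrangeForm_of_fibreFamily` holds at the base
member `U₀` of any supplier family through the minimal orbit over `V^{(k)}_{ax}(W_B)` (that orbit is the gauge orbit of `U_{k+1}(W_B)`, [I] (2.2)–(2.3)). [cite: Balaban1987RG1, (0.4) p.253, (0.21) p.256, (2.2)–(2.3) p.265] -/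
theorem smallBelow_gaugeAct_recordBgField_of_inRegClass (hε₀ : 0 < ε₀) (hc : ε₀ ≤ 1 / (53581824 * (F.L : ℝ) ^ 6))
    {B : recordW F a₀ ε₂₉ k (recordK₀ F Mc k + n)} (hB : InRegClass F Mc k ε₀ a₀ ε₂₉ n B) (u : GaugeTransf (F.P (recordK₀ F Mc k + n)) 0 (SU 2)) :
    letI θ := thetaFill F a₀ ε₂₉
    SmallBelow (avOfRecord F 2 (recordK₀ F Mc k + n)) k (GaugeField.gaugeAct u (recordBgField F θ k (recordK₀ F Mc k + n) B)) :=
  smallBelow_gaugeAct (P := F.P (recordK₀ F Mc k + n)) (Nat.le_of_succ_le (succ_le_m_add_K_recordK₀ F Mc k n)) u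
    (smallBelow_recordBgField_of_inRegClass F a₀ ε₂₉ Mc k n hε₀ hc hB)

end ClassGuard

/-! ## §6 (v3, append-only)  The same family inhabits the selector row (a′): `recordAUk … Vk` is as smooth at `0` as the family -/

section SelectorRow

variable {k K : ℕ} {εbg : ℝ}

/-- ★★ **ONE DELIVERABLE, TWO ROWS**: if every member `U₀·exp(X x)` (for `x` near `0`) is a (0.21) minimiser over `V′_xV^{(k)}` in the class of radius `εbg`, then the value function
`recordAUk … Vk` IS `x ↦ A(U₀·exp(X x))` near `0` (§5, «min = min») and hence is `Cⁿ` at `0` whenever `X` is (the action along the exponential chart is `C^ω`, lit ✓`contDiff_wilsonAction4_expChart`).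
At `n = 2` this is the body of ✓`RegSelSmoothOnClass` at the class point: the supplier's minimiser family of ✓`recordΔk₁_eq_lagrangeForm_of_minimiserFamily` ALSO inhabits (a′).
[cite: Balaban1985Variational, Prop. 9 p.309, p.307 L1–8; Balaban1987RG1, (0.21) p.256, (2.6) p.266] -/
theorem contDiffAt_recordAUk_of_minimiserFamily {n : WithTop ℕ∞} (hk : k ≤ (F.P K).m + (F.P K).K) (Vk : GaugeField (F.P K) k (SU 2)) (U₀ : GaugeField (F.P K) 0 (SU 2))
    {X : (FluctIdx F k K → ℝ) → (PBond (F.P K) 0 → lieSU (Fin 2))} (hXc : ContDiffAt ℝ n X 0)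
    (hmin : ∀ᶠ x in 𝓝 (0 : FluctIdx F k K → ℝ), IsBackground (avOfRecord F 2 K) (bgReg F 2 K k εbg) k (pert F k K Vk x) (expChart U₀ (X x))) :
    ContDiffAt ℝ n (recordAUk F k K εbg Vk) 0 := by
  have hval : recordAUk F k K εbg Vk =ᶠ[𝓝 (0 : FluctIdx F k K → ℝ)] fun x => wilsonAction4 (expChart U₀ (X x)) :=
    hmin.mono fun _ hx => recordAUk_eq_of_isBackground F hk Vk hx
  have hA : ContDiffAt ℝ n (fun Y : PBond (F.P K) 0 → lieSU (Fin 2) => wilsonAction4 (expChart U₀ Y)) (X 0) :=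
    ((contDiff_wilsonAction4_expChart U₀).of_le le_top).contDiffAt
  exact (hA.comp 0 hXc).congr_of_eventuallyEq hval

end SelectorRow

end Summit.QuantumFields.YangMills.Theorems.BalabanUVNodesPortS1

end
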